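import Literature.NumberTheory.Transcendental.RoySmallValueAsymptotics
import Literature.NumberTheory.Transcendental.RoySmallValueEventually
import Mathlib.Analysis.SpecialFunctions.Pow.Real
import HarnessLib

/-!
# Roy's small value estimate for `𝔾ₐ × 𝔾ₘ` — the numerical thresholds of §7 ("for `D` large enough")

Topic `Literature/NumberTheory/Transcendental`. Part of the formalisation of the proof of Roy 2013,
Theorem 1.1 (named fact `roy2013_thm_1_1`, `RoySmallValueEstimates.lean`), seat B. Source: D. Roy,
*A small value estimate for `𝔾ₐ × 𝔾ₘ`*, Mathematika 59 (2013) 333–363 = arXiv:1301.0663, §7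
(pp. 18–19): every step holds "for `D` sufficiently large" because `1 ≤ τ < 2`, `τ < β`,
`τ + ν > 2 + β`:

> `‖Q‖ ≤ (D+1)^{2D^τ+1} exp(D^β) = exp((1+o(1))D^β)` [...] `= exp(−(1−o(1))D^ν)` [...]
> assuming that `D` is sufficiently large, the hypotheses of Proposition 6.4 are all fulfilled
> [...] `C'' = (C−5)/6 ≥ D^δ/25` [...] if `D` is large enough (because `β > τ ≥ 1`) [...]

This file proves, as `∀ᶠ n : ℕ in atTop` statements with the parameters of this development
(`T = ⌊n^τ⌋`, `Y = 3n^β`, `U = n^ν/4`), the concrete inequalities consumed by the assembly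
(`RoySmallValueMain`): the comparisons behind `𝒟ʲP̃_D, Q_D ∈ 𝒞_D` (Step 1), the size of the
interpolation constant (Prop. 6.1), `log ε ≤ −TU/2` and the bound `B ≤ 40 n^{2+β}` (Step 2), the
largeness at the level `D*` (Step 4). Tools: `eventually_nat_mul_rpow_mul_log_pow_le` (parallel
seat's `RoySmallValueAsymptotics`) and `RoySmallValueEventually`. Everything is proved; no
definitions, no named facts.

## References

* [Roy2013] D. Roy, *A small value estimate for 𝔾ₐ × 𝔾ₘ*, Mathematika 59 (2013), 333–363
  (arXiv:1301.0663), §7, Steps 1–5 (the conditions "for `D` large enough").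
-/

noncomputable section

open Filter Real Finset

namespace Literature.NumberTheory.Transcendental

namespace Roy2013

/-! ### Generic helpers -/

/-- `x^m = exp(m log x)` for `x > 0`. [folklore] -/
theorem pow_eq_exp_mul_log {x : ℝ} (hx : 0 < x) (m : ℕ) : x ^ m = Real.exp (m * Real.log x) := by
  rw [Real.exp_nat_mul, Real.exp_log hx]

/-- A sum of three terms each `≤ c/3` is `≤ c`. [folklore] -/
theorem add_three_le {a b c d : ℝ} (ha : a ≤ d / 3) (hb : b ≤ d / 3) (hc : c ≤ d / 3) : a + b + c ≤ d := by
  linarith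

/-- `C n^a (log n)^m ≤ n^b / q` eventually (`a < b`, `q > 0`). [folklore] -/
theorem eventually_term_le_div (a b C : ℝ) (m : ℕ) {q : ℝ} (hq : 0 < q) (hab : a < b) :
    ∀ᶠ n : ℕ in atTop, C * (n : ℝ) ^ a * Real.log n ^ m ≤ (n : ℝ) ^ b / q := by
  filter_upwards [eventually_nat_mul_rpow_mul_log_pow_le' a b C m (c := q⁻¹) (inv_pos.mpr hq) hab]
    with n hn
  rw [div_eq_mul_inv, mul_comm _ q⁻¹]; exact hn

/-! ### The integer `T = ⌊n^τ⌋` -/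

/-- `n ≤ T` for `τ ≥ 1`. [folklore] -/
theorem self_le_natFloor_rpow {τ : ℝ} (hτ : 1 ≤ τ) (n : ℕ) : n ≤ ⌊(n : ℝ) ^ τ⌋₊ := by
  rcases Nat.eq_zero_or_pos n with rfl | hn
  · simp
  · apply Nat.le_floor
    have h1 : (1 : ℝ) ≤ n := by exact_mod_cast hn
    calc (n : ℝ) = (n : ℝ) ^ (1 : ℝ) := (Real.rpow_one _).symm
      _ ≤ (n : ℝ) ^ τ := Real.rpow_le_rpow_of_exponent_le h1 hτ

/-- `36 T ≤ n²` eventually (`τ < 2`). [folklore] -/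
theorem eventually_36_mul_natFloor_le_sq {τ : ℝ} (hτ : τ < 2) :
    ∀ᶠ n : ℕ in atTop, 36 * ⌊(n : ℝ) ^ τ⌋₊ ≤ n ^ 2 := by
  filter_upwards [eventually_const_mul_rpow_le_rpow 36 hτ] with n hn
  have h1 : (36 : ℝ) * ⌊(n : ℝ) ^ τ⌋₊ ≤ 36 * (n : ℝ) ^ τ :=
    mul_le_mul_of_nonneg_left (natFloor_rpow_le n τ) (by norm_num)
  have h2 : (n : ℝ) ^ (2 : ℝ) = (n : ℝ) ^ (2 : ℕ) := Real.rpow_two _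
  have h3 : (36 : ℝ) * ⌊(n : ℝ) ^ τ⌋₊ ≤ (n : ℝ) ^ (2 : ℕ) := by rw [← h2]; exact h1.trans hn
  exact_mod_cast h3

/-- `T ≤ binom(n+1, 2)` eventually (`τ < 2`). [cite: Roy2013, §7 Step 3 ("for `D` large enough, we also have `⌊(D*+1)^τ⌋ ≤ binom(D*+2,2)`")] -/
theorem eventually_natFloor_le_choose {τ : ℝ} (hτ : τ < 2) :
    ∀ᶠ n : ℕ in atTop, ⌊(n : ℝ) ^ τ⌋₊ ≤ (n + 1).choose 2 := by
  filter_upwards [eventually_mul_natFloor_rpow_le_choose 1 hτ] with n hn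
  rw [one_mul] at hn; exact_mod_cast hn

/-- `n² < 2^n` for `n ≥ 5`, eventually. [folklore] -/
theorem eventually_sq_lt_two_pow : ∀ᶠ n : ℕ in atTop, n ^ 2 < 2 ^ n := by
  filter_upwards [eventually_ge_atTop 5] with n hn
  induction n, hn using Nat.le_induction with
  | base => norm_num
  | succ m hm ih =>
    have h1 : (m + 1) ^ 2 ≤ 2 * m ^ 2 := by nlinarith
    calc (m + 1) ^ 2 ≤ 2 * m ^ 2 := h1
      _ < 2 * 2 ^ m := by linarith
      _ = 2 ^ (m + 1) := by ring

/-! ### Step 1: `𝒟ʲP̃_D ∈ 𝒞_D` and `Q_D ∈ 𝒞_D` -/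

/-- **Norm side of Step 1**: `n^{2T} (n+1)² ≤ exp(n^β)` eventually (`τ < β`).
[cite: Roy2013, §7, Step 1 ("`(D+1)^{2D^τ+1} exp(D^β) = exp((1+o(1))D^β)`")] -/
theorem eventually_step1_norm {τ β : ℝ} (hτβ : τ < β) (hβ : 0 < β) :
    ∀ᶠ n : ℕ in atTop, (n : ℝ) ^ (2 * ⌊(n : ℝ) ^ τ⌋₊) * (((n + 1) ^ 2 : ℕ) : ℝ) ≤
      Real.exp ((n : ℝ) ^ β) := by
  filter_upwards [eventually_term_le_div τ β 2 1 (q := 3) three_pos hτβ,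
    eventually_term_le_div 0 β 2 1 (q := 3) three_pos hβ,
    eventually_term_le_div 0 β (2 * Real.log 2) 0 (q := 3) three_pos hβ,
    eventually_ge_atTop 1] with n h1 h2 h3 hn
  have hx : (0 : ℝ) < n := by exact_mod_cast hn
  have hx1 : (1 : ℝ) ≤ n := by exact_mod_cast hn
  simp only [Real.rpow_zero, pow_one, pow_zero, mul_one] at h1 h2 h3
  have hT : (⌊(n : ℝ) ^ τ⌋₊ : ℝ) ≤ (n : ℝ) ^ τ := natFloor_rpow_le n τ
  have hlog : 0 ≤ Real.log n := Real.log_nonneg hx1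
  -- exponents
  have e1 : (n : ℝ) ^ (2 * ⌊(n : ℝ) ^ τ⌋₊) = Real.exp ((2 * ⌊(n : ℝ) ^ τ⌋₊ : ℕ) * Real.log n) :=
    pow_eq_exp_mul_log hx _
  have e2 : (((n + 1) ^ 2 : ℕ) : ℝ) = Real.exp (2 * Real.log (n + 1)) := by
    have : (0 : ℝ) < n + 1 := by linarith
    rw [show (2 : ℝ) * Real.log (n + 1) = ((2 : ℕ) : ℝ) * Real.log (n + 1) by norm_num,
      ← pow_eq_exp_mul_log this]; push_cast; ring
  rw [e1, e2, ← Real.exp_add]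
  refine Real.exp_le_exp.mpr ?_
  have hb1 : ((2 * ⌊(n : ℝ) ^ τ⌋₊ : ℕ) : ℝ) * Real.log n ≤ 2 * (n : ℝ) ^ τ * Real.log n := by
    push_cast; nlinarith
  have hb2 : Real.log ((n : ℝ) + 1) ≤ Real.log 2 + Real.log n := by
    rw [← Real.log_mul two_ne_zero hx.ne']; exact Real.log_le_log (by linarith) (by linarith)
  nlinarith

/-- **Value side of Step 1**: `(2n+1)^{3T} M^n exp(−n^ν) ≤ exp(−n^ν/2)` eventually (`M ≥ 1`,
`τ < ν`, `1 < ν`). [cite: Roy2013, §7, Step 1 ("`= exp(−(1−o(1))D^ν)`")] -/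
theorem eventually_step1_value {τ ν M : ℝ} (hτν : τ < ν) (hν : 1 < ν) (hM : 1 ≤ M) :
    ∀ᶠ n : ℕ in atTop, (2 * n + 1 : ℝ) ^ (3 * ⌊(n : ℝ) ^ τ⌋₊) * M ^ n * Real.exp (-(n : ℝ) ^ ν) ≤
      Real.exp (-((n : ℝ) ^ ν / 2)) := by
  filter_upwards [eventually_term_le_div τ ν (3 * Real.log 3) 0 (q := 6) (by norm_num) hτν,
    eventually_term_le_div τ ν 3 1 (q := 6) (by norm_num) hτν,
    eventually_term_le_div 1 ν (Real.log M) 0 (q := 6) (by norm_num) hν,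
    eventually_ge_atTop 1] with n h1 h2 h3 hn
  have hx : (0 : ℝ) < n := by exact_mod_cast hn
  have hx1 : (1 : ℝ) ≤ n := by exact_mod_cast hn
  simp only [Real.rpow_one, pow_one, pow_zero, mul_one] at h1 h2 h3
  have hT : (⌊(n : ℝ) ^ τ⌋₊ : ℝ) ≤ (n : ℝ) ^ τ := natFloor_rpow_le n τ
  have hT0 : (0 : ℝ) ≤ ⌊(n : ℝ) ^ τ⌋₊ := Nat.cast_nonneg _
  have hlog : 0 ≤ Real.log n := Real.log_nonneg hx1
  have hM0 : 0 < M := by linarith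
  have e1 : (2 * n + 1 : ℝ) ^ (3 * ⌊(n : ℝ) ^ τ⌋₊) =
      Real.exp ((3 * ⌊(n : ℝ) ^ τ⌋₊ : ℕ) * Real.log (2 * n + 1)) := pow_eq_exp_mul_log (by linarith) _
  have e2 : M ^ n = Real.exp (n * Real.log M) := pow_eq_exp_mul_log hM0 _
  rw [e1, e2, ← Real.exp_add, ← Real.exp_add]
  refine Real.exp_le_exp.mpr ?_
  have hb2 : Real.log (2 * (n : ℝ) + 1) ≤ Real.log 3 + Real.log n := by
    rw [← Real.log_mul three_ne_zero hx.ne']; exact Real.log_le_log (by linarith) (by linarith)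
  have hlog3 : 0 ≤ Real.log (2 * (n : ℝ) + 1) := Real.log_nonneg (by linarith)
  have hb1 : ((3 * ⌊(n : ℝ) ^ τ⌋₊ : ℕ) : ℝ) * Real.log (2 * n + 1) ≤
      3 * (n : ℝ) ^ τ * (Real.log 3 + Real.log n) := by
    push_cast
    calc (3 : ℝ) * ⌊(n : ℝ) ^ τ⌋₊ * Real.log (2 * n + 1) ≤ 3 * (n : ℝ) ^ τ * Real.log (2 * n + 1) := by
          nlinarith
      _ ≤ 3 * (n : ℝ) ^ τ * (Real.log 3 + Real.log n) :=
          mul_le_mul_of_nonneg_left hb2 (by positivity)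
  nlinarith

/-- **The companion `Q`**: `n (n²)^n exp(2n^β) ≤ exp(3n^β)` eventually (`β > 1`).
[cite: Roy2013, §6, proof of Prop. 6.4 (`‖Q‖`)] -/
theorem eventually_levelQ_norm {β : ℝ} (hβ : 1 < β) :
    ∀ᶠ n : ℕ in atTop, (n : ℝ) * ((n : ℝ) ^ 2) ^ n * Real.exp (2 * (n : ℝ) ^ β) ≤
      Real.exp (3 * (n : ℝ) ^ β) := by
  filter_upwards [eventually_term_le_div 0 β 1 1 (q := 2) two_pos (by linarith),
    eventually_term_le_div 1 β 2 1 (q := 2) two_pos hβ, eventually_ge_atTop 1] with n h1 h2 hn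
  have hx : (0 : ℝ) < n := by exact_mod_cast hn
  simp only [Real.rpow_zero, Real.rpow_one, pow_one, mul_one, one_mul] at h1 h2
  have e2 : ((n : ℝ) ^ 2) ^ n = Real.exp (n * (2 * Real.log n)) := by
    rw [pow_eq_exp_mul_log (pow_pos hx 2), Real.log_pow]; norm_num
  have e3 : (n : ℝ) * ((n : ℝ) ^ 2) ^ n = Real.exp (Real.log n + n * (2 * Real.log n)) := by
    rw [Real.exp_add, Real.exp_log hx, ← e2]
  rw [e3, ← Real.exp_add]
  exact Real.exp_le_exp.mpr (by nlinarith)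

/-- **The companion `Q`, value side**: `n (n²)^n exp(−n^ν/2) ≤ exp(−n^ν/4)` eventually (`ν > 1`).
[cite: Roy2013, §6, proof of Prop. 6.4] -/
theorem eventually_levelQ_value {ν : ℝ} (hν : 1 < ν) :
    ∀ᶠ n : ℕ in atTop, (n : ℝ) * ((n : ℝ) ^ 2) ^ n * Real.exp (-((n : ℝ) ^ ν / 2)) ≤
      Real.exp (-((n : ℝ) ^ ν / 4)) := by
  filter_upwards [eventually_term_le_div 0 ν 1 1 (q := 8) (by norm_num) (by linarith),
    eventually_term_le_div 1 ν 2 1 (q := 8) (by norm_num) hν, eventually_ge_atTop 1] with n h1 h2 hn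
  have hx : (0 : ℝ) < n := by exact_mod_cast hn
  simp only [Real.rpow_zero, Real.rpow_one, pow_one, mul_one, one_mul] at h1 h2
  have e2 : ((n : ℝ) ^ 2) ^ n = Real.exp (n * (2 * Real.log n)) := by
    rw [pow_eq_exp_mul_log (pow_pos hx 2), Real.log_pow]; norm_num
  have e3 : (n : ℝ) * ((n : ℝ) ^ 2) ^ n = Real.exp (Real.log n + n * (2 * Real.log n)) := by
    rw [Real.exp_add, Real.exp_log hx, ← e2]
  rw [e3, ← Real.exp_add]
  exact Real.exp_le_exp.mpr (by nlinarith)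

/-! ### Proposition 6.1: the interpolation constant -/

/-- **`c₁^T (4(T+1))^{3T} ≤ exp(3n^β)`** eventually (`c₁ ≥ 1`, `τ < β`).
[cite: Roy2013, Proposition 6.1 (hypothesis `2T log c₆ ≤ Y`)] -/
theorem eventually_interp_const {τ β c₁ : ℝ} (hτ0 : 0 < τ) (hτβ : τ < β) (hc₁ : 1 ≤ c₁) :
    ∀ᶠ n : ℕ in atTop, c₁ ^ ⌊(n : ℝ) ^ τ⌋₊ * (4 * ((⌊(n : ℝ) ^ τ⌋₊ : ℝ) + 1)) ^ (3 * ⌊(n : ℝ) ^ τ⌋₊) ≤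
      Real.exp (3 * (n : ℝ) ^ β) := by
  filter_upwards [eventually_term_le_div τ β (Real.log c₁) 0 (q := 1) one_pos hτβ,
    eventually_term_le_div τ β (3 * Real.log 8) 0 (q := 1) one_pos hτβ,
    eventually_term_le_div τ β (3 * τ) 1 (q := 1) one_pos hτβ, eventually_ge_atTop 1] with n h1 h2 h3 hn
  have hx : (0 : ℝ) < n := by exact_mod_cast hn
  have hx1 : (1 : ℝ) ≤ n := by exact_mod_cast hn
  simp only [pow_zero, mul_one, div_one, pow_one] at h1 h2 h3
  have hT : (⌊(n : ℝ) ^ τ⌋₊ : ℝ) ≤ (n : ℝ) ^ τ := natFloor_rpow_le n τ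
  have hT1 : (1 : ℝ) ≤ ⌊(n : ℝ) ^ τ⌋₊ := by exact_mod_cast one_le_natFloor_rpow hn hτ0.le
  have hc0 : 0 < c₁ := by linarith
  have hlog : 0 ≤ Real.log n := Real.log_nonneg hx1
  have hlogc : 0 ≤ Real.log c₁ := Real.log_nonneg hc₁
  have e1 : c₁ ^ ⌊(n : ℝ) ^ τ⌋₊ = Real.exp (⌊(n : ℝ) ^ τ⌋₊ * Real.log c₁) := pow_eq_exp_mul_log hc0 _
  have e2 : (4 * ((⌊(n : ℝ) ^ τ⌋₊ : ℝ) + 1)) ^ (3 * ⌊(n : ℝ) ^ τ⌋₊) =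
      Real.exp ((3 * ⌊(n : ℝ) ^ τ⌋₊ : ℕ) * Real.log (4 * (⌊(n : ℝ) ^ τ⌋₊ + 1))) :=
    pow_eq_exp_mul_log (by positivity) _
  rw [e1, e2, ← Real.exp_add]
  refine Real.exp_le_exp.mpr ?_
  -- `log(4(T+1)) ≤ log 8 + log T ≤ log 8 + τ log n`
  have hlogT : Real.log (⌊(n : ℝ) ^ τ⌋₊ : ℝ) ≤ τ * Real.log n := by
    rw [← Real.log_rpow hx]; exact Real.log_le_log (by linarith) hT
  have hb : Real.log (4 * ((⌊(n : ℝ) ^ τ⌋₊ : ℝ) + 1)) ≤ Real.log 8 + τ * Real.log n := by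
    have h8 : (4 : ℝ) * (⌊(n : ℝ) ^ τ⌋₊ + 1) ≤ 8 * ⌊(n : ℝ) ^ τ⌋₊ := by linarith
    calc Real.log (4 * ((⌊(n : ℝ) ^ τ⌋₊ : ℝ) + 1)) ≤ Real.log (8 * ⌊(n : ℝ) ^ τ⌋₊) :=
          Real.log_le_log (by positivity) h8
      _ = Real.log 8 + Real.log ⌊(n : ℝ) ^ τ⌋₊ := Real.log_mul (by norm_num) (by linarith)
      _ ≤ Real.log 8 + τ * Real.log n := by linarith
  have hb0 : 0 ≤ Real.log (4 * ((⌊(n : ℝ) ^ τ⌋₊ : ℝ) + 1)) := Real.log_nonneg (by linarith)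
  have h4 : ((3 * ⌊(n : ℝ) ^ τ⌋₊ : ℕ) : ℝ) * Real.log (4 * (⌊(n : ℝ) ^ τ⌋₊ + 1)) ≤
      3 * (n : ℝ) ^ τ * (Real.log 8 + τ * Real.log n) := by
    push_cast
    calc (3 : ℝ) * ⌊(n : ℝ) ^ τ⌋₊ * Real.log (4 * (⌊(n : ℝ) ^ τ⌋₊ + 1))
        ≤ 3 * (n : ℝ) ^ τ * Real.log (4 * (⌊(n : ℝ) ^ τ⌋₊ + 1)) := by nlinarith
      _ ≤ 3 * (n : ℝ) ^ τ * (Real.log 8 + τ * Real.log n) := mul_le_mul_of_nonneg_left hb (by positivity)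
  have h5 : (⌊(n : ℝ) ^ τ⌋₊ : ℝ) * Real.log c₁ ≤ (n : ℝ) ^ τ * Real.log c₁ :=
    mul_le_mul_of_nonneg_right hT hlogc
  nlinarith

/-! ### Step 2: `log ε ≤ −TU/2`, the bound `B`, the constant `Γ''` -/

/-- **`log ε + TU ≤ TU/2`**: `4 log 2 · n³ + N log N + N (log 3 + 3n^β) + 3n^β n² ≤ T (n^ν/4)/2`
eventually, `N = binom(3n+2, 2)`, `T = ⌊n^τ⌋` (`2 + β < τ + ν`, `3 < τ + ν`, `τ ≥ 0`).
[cite: Roy2013, Propositions 6.1–6.2 and §7 Step 2 (`C'' ≥ D^δ/25`)] -/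
theorem eventually_log_eps {τ β ν : ℝ} (hτ0 : 0 ≤ τ) (h1 : 2 + β < τ + ν) (h2 : 3 < τ + ν) :
    ∀ᶠ n : ℕ in atTop, 4 * Real.log 2 * (n : ℝ) ^ 3 +
        ((3 * n + 2).choose 2 : ℝ) * Real.log ((3 * n + 2).choose 2 : ℝ) +
        ((3 * n + 2).choose 2 : ℝ) * (Real.log 3 + 3 * (n : ℝ) ^ β) + 3 * (n : ℝ) ^ β * (n : ℝ) ^ 2 ≤
      ⌊(n : ℝ) ^ τ⌋₊ * ((n : ℝ) ^ ν / 4) / 2 := by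
  have h2' : (2 : ℝ) < τ + ν := by linarith
  filter_upwards [eventually_term_le_div 3 (τ + ν) (4 * Real.log 2) 0 (q := 96) (by norm_num) h2,
    eventually_term_le_div 2 (τ + ν) (10 * Real.log 10) 0 (q := 96) (by norm_num) h2',
    eventually_term_le_div 2 (τ + ν) 20 1 (q := 96) (by norm_num) h2',
    eventually_term_le_div 2 (τ + ν) (10 * Real.log 3) 0 (q := 96) (by norm_num) h2',
    eventually_term_le_div (2 + β) (τ + ν) 30 0 (q := 96) (by norm_num) h1,
    eventually_term_le_div (2 + β) (τ + ν) 3 0 (q := 96) (by norm_num) h1,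
    eventually_ge_atTop 1] with n e1 e2 e3 e4 e5 e6 hn
  have hx : (0 : ℝ) < n := by exact_mod_cast hn
  have hx1 : (1 : ℝ) ≤ n := by exact_mod_cast hn
  simp only [pow_zero, mul_one, pow_one] at e1 e2 e3 e4 e5 e6
  have hlog : 0 ≤ Real.log n := Real.log_nonneg hx1
  -- `N ≤ 10 n²`, `1 ≤ N`
  have hN : ((3 * n + 2).choose 2 : ℝ) ≤ 10 * (n : ℝ) ^ 2 := choose_three_le hn
  have hN1 : (1 : ℝ) ≤ ((3 * n + 2).choose 2 : ℝ) := by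
    have : 1 ≤ (3 * n + 2).choose 2 := Nat.choose_pos (by omega)
    exact_mod_cast this
  have hNlog : Real.log ((3 * n + 2).choose 2 : ℝ) ≤ Real.log 10 + 2 * Real.log n := by
    calc Real.log ((3 * n + 2).choose 2 : ℝ) ≤ Real.log (10 * (n : ℝ) ^ 2) :=
          Real.log_le_log (by linarith) hN
      _ = Real.log 10 + 2 * Real.log n := by
          rw [Real.log_mul (by norm_num) (pow_pos hx 2).ne', Real.log_pow]; norm_num
  have hNlog0 : 0 ≤ Real.log ((3 * n + 2).choose 2 : ℝ) := Real.log_nonneg hN1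
  -- `T ≥ n^τ/2`
  have hT : (n : ℝ) ^ τ ≤ 2 * ⌊(n : ℝ) ^ τ⌋₊ := rpow_le_two_mul_natFloor hn hτ0
  -- rewrite the powers
  have hp3 : (n : ℝ) ^ (3 : ℝ) = (n : ℝ) ^ (3 : ℕ) := by exact_mod_cast Real.rpow_natCast (n : ℝ) 3
  have hp2 : (n : ℝ) ^ (2 : ℝ) = (n : ℝ) ^ (2 : ℕ) := Real.rpow_two _
  have hp2b : (n : ℝ) ^ (2 + β) = (n : ℝ) ^ (2 : ℕ) * (n : ℝ) ^ β := by
    rw [Real.rpow_add hx, hp2]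
  have hptn : (n : ℝ) ^ (τ + ν) = (n : ℝ) ^ τ * (n : ℝ) ^ ν := Real.rpow_add hx _ _
  rw [hp3] at e1; rw [hp2] at e2 e3 e4; rw [hp2b] at e5 e6; rw [hptn] at e1 e2 e3 e4 e5 e6
  have hν0 : 0 ≤ (n : ℝ) ^ ν := Real.rpow_nonneg hx.le _
  have hβ0 : 0 ≤ (n : ℝ) ^ β := Real.rpow_nonneg hx.le _
  -- assemble
  have hA : ((3 * n + 2).choose 2 : ℝ) * Real.log ((3 * n + 2).choose 2 : ℝ) ≤
      10 * Real.log 10 * (n : ℝ) ^ 2 + 20 * (n : ℝ) ^ 2 * Real.log n := by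
    calc ((3 * n + 2).choose 2 : ℝ) * Real.log ((3 * n + 2).choose 2 : ℝ)
        ≤ (10 * (n : ℝ) ^ 2) * (Real.log 10 + 2 * Real.log n) :=
          mul_le_mul hN hNlog hNlog0 (by positivity)
      _ = _ := by ring
  have hB : ((3 * n + 2).choose 2 : ℝ) * (Real.log 3 + 3 * (n : ℝ) ^ β) ≤
      10 * Real.log 3 * (n : ℝ) ^ 2 + 30 * ((n : ℝ) ^ 2 * (n : ℝ) ^ β) := by
    have : 0 ≤ Real.log 3 + 3 * (n : ℝ) ^ β := by positivity
    calc ((3 * n + 2).choose 2 : ℝ) * (Real.log 3 + 3 * (n : ℝ) ^ β)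
        ≤ (10 * (n : ℝ) ^ 2) * (Real.log 3 + 3 * (n : ℝ) ^ β) := mul_le_mul_of_nonneg_right hN this
      _ = _ := by ring
  have hR : (n : ℝ) ^ τ * (n : ℝ) ^ ν / 16 ≤ ⌊(n : ℝ) ^ τ⌋₊ * ((n : ℝ) ^ ν / 4) / 2 := by nlinarith
  nlinarith

/-- **The bound `B`**: `N log N ≤ 7 n^{2+β}` eventually (`β > 0`), `N = binom(3n+2,2)`; with
`Y n² + 30 n^{2+β}` this gives `B ≤ 40 n^{2+β}`. [cite: Roy2013, Prop. 6.4 (`h(Z) ≤ 3DY/T`) and §7 Step 2] -/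
theorem eventually_N_log_N {β : ℝ} (hβ : 0 < β) :
    ∀ᶠ n : ℕ in atTop, ((3 * n + 2).choose 2 : ℝ) * Real.log ((3 * n + 2).choose 2 : ℝ) ≤
      7 * (n : ℝ) ^ (2 + β) := by
  filter_upwards [eventually_term_le_div 2 (2 + β) (10 * Real.log 10) 0 (q := 2⁻¹ * 7⁻¹⁻¹ / 7 * 2) (by norm_num) (by linarith),
    eventually_term_le_div 2 (2 + β) 20 1 (q := 2 / 7 * 1) (by norm_num) (by linarith),
    eventually_ge_atTop 1] with n e1 e2 hn
  have hx : (0 : ℝ) < n := by exact_mod_cast hn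
  have hx1 : (1 : ℝ) ≤ n := by exact_mod_cast hn
  simp only [pow_zero, mul_one, pow_one] at e1 e2
  have hlog : 0 ≤ Real.log n := Real.log_nonneg hx1
  have hN : ((3 * n + 2).choose 2 : ℝ) ≤ 10 * (n : ℝ) ^ 2 := choose_three_le hn
  have hN1 : (1 : ℝ) ≤ ((3 * n + 2).choose 2 : ℝ) := by
    have : 1 ≤ (3 * n + 2).choose 2 := Nat.choose_pos (by omega)
    exact_mod_cast this
  have hNlog : Real.log ((3 * n + 2).choose 2 : ℝ) ≤ Real.log 10 + 2 * Real.log n := by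
    calc Real.log ((3 * n + 2).choose 2 : ℝ) ≤ Real.log (10 * (n : ℝ) ^ 2) :=
          Real.log_le_log (by linarith) hN
      _ = Real.log 10 + 2 * Real.log n := by
          rw [Real.log_mul (by norm_num) (pow_pos hx 2).ne', Real.log_pow]; norm_num
  have hNlog0 : 0 ≤ Real.log ((3 * n + 2).choose 2 : ℝ) := Real.log_nonneg hN1
  have hp2 : (n : ℝ) ^ (2 : ℝ) = (n : ℝ) ^ (2 : ℕ) := Real.rpow_two _
  rw [hp2] at e1 e2
  have h0 : 0 ≤ (n : ℝ) ^ (2 + β) := Real.rpow_nonneg hx.le _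
  calc ((3 * n + 2).choose 2 : ℝ) * Real.log ((3 * n + 2).choose 2 : ℝ)
      ≤ (10 * (n : ℝ) ^ 2) * (Real.log 10 + 2 * Real.log n) := mul_le_mul hN hNlog hNlog0 (by positivity)
    _ = 10 * Real.log 10 * (n : ℝ) ^ 2 + 20 * (n : ℝ) ^ 2 * Real.log n := by ring
    _ ≤ 7 * (n : ℝ) ^ (2 + β) := by nlinarith

/-! ### Step 4: largeness at the level `D*` -/

/-- **The largeness condition of Step 4**:
`log 2 + 2c₂² + n (A₃ n^{1+β−τ}) + 8 n^{2−τ} (n log 3 + 3 n^β) < n^ν/4` eventually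
(`2 + β − τ < ν`, `τ ≥ 1`). [cite: Roy2013, §7, Step 4 ("if `D*` is large enough")] -/
theorem eventually_step4_big {τ β ν c A₃ : ℝ} (hτ1 : 1 ≤ τ) (hν : 2 + β - τ < ν) (hβ : τ < β) :
    ∀ᶠ n : ℕ in atTop, c + (n : ℝ) * (A₃ * (n : ℝ) ^ (1 + β - τ)) +
        8 * (n : ℝ) ^ (2 - τ) * ((n : ℝ) * Real.log 3 + 3 * (n : ℝ) ^ β) < (n : ℝ) ^ ν / 4 := by
  have h3τ : 3 - τ < ν := by linarith
  filter_upwards [eventually_term_le_div 0 ν c 0 (q := 20) (by norm_num) (by linarith),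
    eventually_term_le_div (2 + β - τ) ν A₃ 0 (q := 20) (by norm_num) hν,
    eventually_term_le_div (3 - τ) ν (8 * Real.log 3) 0 (q := 20) (by norm_num) h3τ,
    eventually_term_le_div (2 + β - τ) ν 24 0 (q := 20) (by norm_num) hν,
    eventually_ge_atTop 1] with n e1 e2 e3 e4 hn
  have hx : (0 : ℝ) < n := by exact_mod_cast hn
  simp only [Real.rpow_zero, pow_zero, mul_one] at e1 e2 e3 e4
  have hpa : (n : ℝ) * (A₃ * (n : ℝ) ^ (1 + β - τ)) = A₃ * (n : ℝ) ^ (2 + β - τ) := by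
    rw [show (2 : ℝ) + β - τ = 1 + (1 + β - τ) by ring, Real.rpow_add hx, Real.rpow_one]; ring
  have hpb : (n : ℝ) ^ (2 - τ) * (n : ℝ) = (n : ℝ) ^ (3 - τ) := by
    rw [show (3 : ℝ) - τ = (2 - τ) + 1 by ring, Real.rpow_add hx, Real.rpow_one]
  have hpc : (n : ℝ) ^ (2 - τ) * (n : ℝ) ^ β = (n : ℝ) ^ (2 + β - τ) := by
    rw [show (2 : ℝ) + β - τ = (2 - τ) + β by ring, Real.rpow_add hx]
  have hexp : 8 * (n : ℝ) ^ (2 - τ) * ((n : ℝ) * Real.log 3 + 3 * (n : ℝ) ^ β) =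
      8 * Real.log 3 * (n : ℝ) ^ (3 - τ) + 24 * (n : ℝ) ^ (2 + β - τ) := by
    rw [← hpb, ← hpc]; ring
  rw [hpa, hexp]
  have hν0 : 0 < (n : ℝ) ^ ν := Real.rpow_pos_of_pos hx _
  linarith

/-- **The constant of Step 4**: `2 n log 3 + log 4 + n log c₄ ≤ 2 n^β` eventually (`β > 1`).
[cite: Roy2013, §7, Step 4 ("`max log|P*(α)| ≤ D* log(3) + log‖P*‖ ≤ 4(D*)^β`")] -/
theorem eventually_step4_const {β c : ℝ} (hβ : 1 < β) :
    ∀ᶠ n : ℕ in atTop, 2 * (n : ℝ) * Real.log 3 + Real.log 4 + (n : ℝ) * c ≤ 2 * (n : ℝ) ^ β := by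
  filter_upwards [eventually_term_le_div 1 β (2 * Real.log 3) 0 (q := 2) two_pos hβ,
    eventually_term_le_div 0 β (Real.log 4) 0 (q := 2) two_pos (by linarith),
    eventually_term_le_div 1 β c 0 (q := 2) two_pos hβ, eventually_ge_atTop 1] with n e1 e2 e3 hn
  simp only [Real.rpow_zero, Real.rpow_one, pow_zero, mul_one] at e1 e2 e3
  have h0 : 0 ≤ (n : ℝ) ^ β := Real.rpow_nonneg (Nat.cast_nonneg _) _
  nlinarith

end Roy2013

end Literature.NumberTheory.Transcendental
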